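import Literature.Computability.Complexity.ProofComplexityNP
import Literature.Computability.MetaComplexity.FregeVerifierMachine
import HarnessLib

/-!
# Proof complexity: Frege proofs are polynomial-time verifiable; `NP = coNP` from a polynomially bounded Frege system

Sibling proof file of `ProofComplexityNP.lean` and `ProofComplexity.lean` (D-0014). With the
string-level verifier for `textbookFrege` proofs of
`MetaComplexity/FregeVerifier{Model,Complete,Bricks,Machine}.lean` it discharges

* `Literature.Computability.Complexity.textbookFrege_hasPolyTimeVerifier_holds` — Frege proofs
  (for the concrete system `textbookFrege`) are checkable in polynomial time, with soundness for
  tautologyhood and completeness with polynomial overhead (Cook–Reckhow 1979, closing remark of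
  §1, p. 37 and pp. 39–40);
* `Literature.Computability.MetaComplexity.hasPolyBoundedProofSystem_TAUT_of_isPolyBounded_holds`
  (`Frege.lean`) — a polynomially bounded Frege system gives a polynomially bounded abstract
  proof system for `TAUT` (loc. cit., §1 Def. 1.3 with §2 Cor. 2.4);
* `Literature.Computability.Complexity.NP_eq_coNP_of_isPolyBounded_holds` (`ProofComplexity.lean`,
  corollary of **pnp.S30**) — if some Frege system is polynomially bounded then `NP = coNP`
  (loc. cit., Prop. 1.1, Prop. 1.4, Cor. 2.4).

Deliberately not here: `Literature.Computability.MetaComplexity.exists_isProofSystemFor_of_isFrege`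
(`Frege.lean`), the stronger statement that the verifier of an *arbitrary* Frege system `F` is
polynomially bounded **iff** `F` is; its `→` direction needs, beyond the present verifier, the
comparison of certificate length with `proofSize` for proofs with large variable indices
(renaming into an initial segment), which no current user requires.

## References

* S. A. Cook, R. A. Reckhow, *The relative efficiency of propositional proof systems*,
  J. Symbolic Logic 44 (1979) 36–50: §1 Prop. 1.1, Def. 1.3, Prop. 1.4, closing remark
  (pp. 39–40); §2 Def. 2.1–2.2, Cor. 2.4, Lemma 2.5.
-/

namespace Literature.Computability.Complexity

open _root_.Computability Nondeterministic MetaComplexity Polynomial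

/-- **Discharge of `textbookFrege_hasPolyTimeVerifier`** (Cook–Reckhow 1979, closing remark of
§1): the verifier `FregeVerifier.verifier` — which runs the pool-annotated string checker of
`FregeVerifierModel.lean` as a clocked loop of `FP` bricks — is polynomial time
(`isPolyTimeVerifier_verifier`), sound (`verifier_sound`) and complete with the polynomial
overhead `100 (proofSize π + |encode φ| + 2)^4` (`verifier_complete`).
[cite: CookReckhow1979, §1 (closing remark: conventional proof systems fit Def. 1.3) and §2 Def. 2.1–2.2] -/
theorem textbookFrege_hasPolyTimeVerifier_holds : textbookFrege_hasPolyTimeVerifier :=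
  ⟨FregeVerifier.verifier, FregeVerifier.isPolyTimeVerifier_verifier, FregeVerifier.verifier_sound,
    100 * (X + 2) ^ 4, FregeVerifier.verifier_complete⟩

/-- **Discharge of `hasPolyBoundedProofSystem_TAUT_of_isPolyBounded`** (`Frege.lean`): a
polynomially bounded Frege system yields a polynomially bounded Cook–Reckhow proof system for
`TAUT`. [cite: CookReckhow1979, §1–2] -/
theorem _root_.Literature.Computability.MetaComplexity.hasPolyBoundedProofSystem_TAUT_of_isPolyBounded_holds :
    hasPolyBoundedProofSystem_TAUT_of_isPolyBounded :=
  hasPolyBoundedProofSystem_TAUT_of_isPolyBounded_of_verifier textbookFrege_hasPolyTimeVerifier_holds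

/-- **Discharge of `NP_eq_coNP_of_isPolyBounded`** (corollary of pnp.S30, Cook–Reckhow 1979,
Prop. 1.1 with Prop. 1.4 and Cor. 2.4): if some Frege system is polynomially bounded then
`NP = coNP`. [cite: CookReckhow1979, §1–2] -/
theorem NP_eq_coNP_of_isPolyBounded_holds : NP_eq_coNP_of_isPolyBounded :=
  NP_eq_coNP_of_isPolyBounded_of_verifier textbookFrege_hasPolyTimeVerifier_holds

end Literature.Computability.Complexity
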